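import Summits.AnomalousDissipation.AnomalousDissipation.Theorems.MarginalStabilityChainBurgersLayerKHStubVolterraA

/-!
# Stub `stub_volterra` of the line `Sketch` (crux stmt-AnomalousDissipation-3008), part B:
# the Bielecki contraction on `ℝ →ᵇ ℂ` and the weighted Volterra package

Registered stub, proved here: `theorem stub_volterra : ∀ k : ℕ, 1 ≤ k → ∀ A : ℝ, VolterraPackage k A`
(`VolterraPackage` is the Line-file predicate: an `α`-uniform constant `C` such that for `α ∈ [0,1]`,
continuous `V` with `‖V t‖ ≤ A e^{-t²/4}` and continuous `g` with `‖g y‖ ≤ (1+|y|)^k`, the Jost equation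
`m(y) = g(y) + ∫_{t>y} k_α(t-y) V(t) m(t) dt` has a continuous solution with `‖m y‖ ≤ C (1+|y|)^k`, unique
among continuous functions of polynomial growth of order `k`).

Proof (part A supplies the kernel facts, the weight `W` of `a = A(1+|t|)^{k+1}e^{-t²/4}` and the three
operator facts).  Put `w = (1+|y|)^k W` (`1 ≤ w`, continuous).  On the Banach space `ℝ →ᵇ ℂ` the map
`T n = (g + K(w n))/w` satisfies `‖T n‖ ≤ 1 + ‖n‖/2` and `dist (T n₁) (T n₂) ≤ dist(n₁, n₂)/2`
(`exists_op`, an abstract statement about a kernel with the weighted bound), hence has a unique fixed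
point `n` (`ContractingWith.fixedPoint`), `‖n‖ ≤ 2`.  Then `m = w n` solves the equation with
`‖m y‖ ≤ 2 (1+|y|)^k W(y) ≤ 2 e^{2‖a‖₁} (1+|y|)^k`, so `C = 2 exp(2 ∫ a)` depends on `k, A` only; and
every continuous solution `m'` with `‖m' y‖ ≤ B (1+|y|)^k` gives the fixed point `m'/w`, whence
uniqueness.  `A < 0` reduces to `max A 0` (the potential class shrinks).  Pure proof file; Mathlib only.
-/

-- `Summit.<Summit>.<Problem>` is the tree's mandated summit-side namespace (CONVENTIONS §2); for this
-- single-conjunct summit the two coincide, so the duplicate is deliberate.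
set_option linter.dupNamespace false

noncomputable section

open Complex MeasureTheory Filter Topology Set Metric
open scoped BoundedContinuousFunction

namespace Summit.AnomalousDissipation.AnomalousDissipation.Theorems.BurgersLayerKH.Sheet.Volterra

/-! ## §4 The contraction on `ℝ →ᵇ ℂ` and the package -/

/-- **Abstract Bielecki contraction.** Let `w ≥ 1` be a continuous weight and `K y t` a kernel whose
Volterra operator `f ↦ ∫_{t>y} K y t · f t` maps `‖f‖ ≤ D w` into `‖·‖ ≤ (D/2) w` and preserves
integrability and continuity. Then `n ↦ (g + ∫ K (w n)) / w` is a `1/2`-contraction of `ℝ →ᵇ ℂ`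
(`‖g‖ ≤ w`): it is bounded by `1 + ‖n‖/2` and has exactly one fixed point. [folklore] -/
theorem exists_op {K : ℝ → ℝ → ℂ} {w : ℝ → ℝ} {g : ℝ → ℂ} (hwc : Continuous w)
    (hw1 : ∀ y, 1 ≤ w y) (hg : Continuous g) (hgb : ∀ y, ‖g y‖ ≤ w y)
    (hB : ∀ (f : ℝ → ℂ) (D : ℝ), 0 ≤ D → (∀ t, ‖f t‖ ≤ D * w t) →
      ∀ y, ‖∫ t in Ioi y, K y t * f t‖ ≤ D / 2 * w y)
    (hI : ∀ f : ℝ → ℂ, Continuous f → ∀ D : ℝ, (∀ t, ‖f t‖ ≤ D * w t) →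
      ∀ y, IntegrableOn (fun t => K y t * f t) (Ioi y))
    (hC : ∀ f : ℝ → ℂ, Continuous f → ∀ D : ℝ, (∀ t, ‖f t‖ ≤ D * w t) →
      Continuous fun y => ∫ t in Ioi y, K y t * f t) :
    ∃ T : (ℝ →ᵇ ℂ) → (ℝ →ᵇ ℂ),
      (∀ n : ℝ →ᵇ ℂ, ∀ y : ℝ,
        T n y = ((w y)⁻¹ : ℝ) * (g y + ∫ t in Ioi y, K y t * ((w t : ℂ) * n t))) ∧
      (∀ n : ℝ →ᵇ ℂ, ‖T n‖ ≤ 1 + ‖n‖ / 2) ∧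
      (∃ n, T n = n) ∧ (∀ n₁ n₂, T n₁ = n₁ → T n₂ = n₂ → n₁ = n₂) := by
  have hw0 : ∀ y, 0 < w y := fun y => one_pos.trans_le (hw1 y)
  have hwn : ∀ n : ℝ →ᵇ ℂ, (Continuous fun t => (w t : ℂ) * n t) ∧
      ∀ t, ‖(w t : ℂ) * n t‖ ≤ ‖n‖ * w t := fun n =>
    ⟨(Complex.continuous_ofReal.comp hwc).mul n.continuous, fun t => by
      rw [norm_mul, Complex.norm_of_nonneg (hw0 t).le, mul_comm]
      exact mul_le_mul_of_nonneg_right (n.norm_coe_le_norm t) (hw0 t).le⟩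
  obtain ⟨S, hS⟩ : ∃ S : (ℝ →ᵇ ℂ) → ℝ → ℂ, ∀ n y,
      S n y = ((w y)⁻¹ : ℝ) * (g y + ∫ t in Ioi y, K y t * ((w t : ℂ) * n t)) :=
    ⟨fun n y => ((w y)⁻¹ : ℝ) * (g y + ∫ t in Ioi y, K y t * ((w t : ℂ) * n t)), fun n y => rfl⟩
  have hSc : ∀ n, Continuous (S n) := fun n => by
    have h1 := hC _ (hwn n).1 ‖n‖ (hwn n).2
    rw [show S n = fun y => ((w y)⁻¹ : ℝ) * (g y + ∫ t in Ioi y, K y t * ((w t : ℂ) * n t)) from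
      funext (hS n)]
    exact (Complex.continuous_ofReal.comp (hwc.inv₀ fun y => (hw0 y).ne')).mul (hg.add h1)
  have hSb : ∀ n y, ‖S n y‖ ≤ 1 + ‖n‖ / 2 := fun n y => by
    have h1 := hB _ ‖n‖ (norm_nonneg n) (hwn n).2 y
    have hwy := (hw0 y).ne'
    rw [hS, norm_mul, Complex.norm_real, Real.norm_of_nonneg (inv_nonneg.2 (hw0 y).le)]
    calc (w y)⁻¹ * ‖g y + ∫ t in Ioi y, K y t * ((w t : ℂ) * n t)‖
        ≤ (w y)⁻¹ * (w y + ‖n‖ / 2 * w y) :=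
          mul_le_mul_of_nonneg_left ((norm_add_le _ _).trans (add_le_add (hgb y) h1))
            (inv_nonneg.2 (hw0 y).le)
      _ = 1 + ‖n‖ / 2 := by
          rw [mul_add, mul_comm (‖n‖ / 2) (w y), ← mul_assoc, inv_mul_cancel₀ hwy, one_mul]
  obtain ⟨T, hT⟩ : ∃ T : (ℝ →ᵇ ℂ) → (ℝ →ᵇ ℂ), ∀ n y, T n y = S n y :=
    ⟨fun n => BoundedContinuousFunction.ofNormedAddCommGroup (S n) (hSc n) _ (hSb n),
      fun n y => rfl⟩
  have hTn : ∀ n, ‖T n‖ ≤ 1 + ‖n‖ / 2 := fun n =>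
    (BoundedContinuousFunction.norm_le (by positivity)).2 fun y => by rw [hT]; exact hSb n y
  have hlip : ∀ n₁ n₂ : ℝ →ᵇ ℂ, dist (T n₁) (T n₂) ≤ 2⁻¹ * dist n₁ n₂ := fun n₁ n₂ => by
    refine (BoundedContinuousFunction.dist_le (by positivity)).2 fun y => ?_
    have hwy := (hw0 y).ne'
    have key : T n₁ y - T n₂ y =
        ((w y)⁻¹ : ℝ) * ∫ t in Ioi y, K y t * ((w t : ℂ) * (n₁ - n₂) t) := by
      rw [hT, hT, hS, hS, ← mul_sub, add_sub_add_left_eq_sub,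
        ← integral_sub (hI _ (hwn n₁).1 _ (hwn n₁).2 y) (hI _ (hwn n₂).1 _ (hwn n₂).2 y)]
      congr 1
      refine integral_congr_ae (Eventually.of_forall fun t => ?_)
      simp only [BoundedContinuousFunction.coe_sub, Pi.sub_apply]
      ring
    have h3 := hB (fun t => (w t : ℂ) * (n₁ - n₂) t) ‖n₁ - n₂‖ (norm_nonneg _)
      (hwn (n₁ - n₂)).2 y
    rw [dist_eq_norm, key, norm_mul, Complex.norm_real,
      Real.norm_of_nonneg (inv_nonneg.2 (hw0 y).le), dist_eq_norm]
    calc (w y)⁻¹ * ‖∫ t in Ioi y, K y t * ((w t : ℂ) * (n₁ - n₂) t)‖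
        ≤ (w y)⁻¹ * (‖n₁ - n₂‖ / 2 * w y) := mul_le_mul_of_nonneg_left h3 (inv_nonneg.2 (hw0 y).le)
      _ = 2⁻¹ * ‖n₁ - n₂‖ := by
          rw [mul_comm (‖n₁ - n₂‖ / 2) (w y), ← mul_assoc, inv_mul_cancel₀ hwy, one_mul,
            div_eq_mul_inv, mul_comm]
  have hcw : ContractingWith 2⁻¹ T := by
    refine ⟨inv_lt_one_of_one_lt₀ one_lt_two, LipschitzWith.of_dist_le_mul fun n₁ n₂ => ?_⟩
    simpa using hlip n₁ n₂
  exact ⟨T, fun n y => by rw [hT, hS], hTn, ⟨ContractingWith.fixedPoint T hcw,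
    hcw.fixedPoint_isFixedPt⟩, fun n₁ n₂ h₁ h₂ => hcw.fixedPoint_unique' h₁ h₂⟩

/-- **The weighted Volterra package for `A ≥ 0`, `k ≥ 1`**, with the `α`-uniform constant
`C = 2 exp(2 ∫ A(1+|t|)^{k+1} e^{-t²/4} dt)`: existence from the fixed point of the Bielecki
contraction (`m = w · n`, `‖n‖ ≤ 2`), uniqueness because every continuous solution of polynomial
growth of order `k` is `w ·` a fixed point. [folklore] -/
theorem volterraPackage_of_nonneg {k : ℕ} (hk : 1 ≤ k) {A : ℝ} (hA : 0 ≤ A) :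
    VolterraPackage k A := by
  have hac : Continuous fun t : ℝ => A * ((1 + |t|) ^ (k + 1) * Real.exp (-(t ^ 2) / 4)) := by
    fun_prop
  have hai := (integrable_pow_mul_gauss (k + 1)).const_mul A
  obtain ⟨W, hWc, hW1, hWL, hW⟩ := exists_weight hac (fun t => by positivity) hai
  obtain ⟨L, hL0, hWL⟩ : ∃ L : ℝ, 0 < L ∧ ∀ y, W y ≤ L := ⟨_, Real.exp_pos _, hWL⟩
  refine ⟨2 * L, fun α hα _ V hV hVb g hg hgb => ?_⟩
  have hw0 : ∀ y, 0 < (1 + |y|) ^ k * W y := fun y =>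
    mul_pos (by positivity) (one_pos.trans_le (hW1 y))
  have hw1 : ∀ y, 1 ≤ (1 + |y|) ^ k * W y := fun y =>
    one_le_mul_of_one_le_of_one_le (one_le_pow₀ (by linarith [abs_nonneg y])) (hW1 y)
  have hwc : Continuous fun y => (1 + |y|) ^ k * W y := by fun_prop
  have hgb' : ∀ y, ‖g y‖ ≤ (1 + |y|) ^ k * W y := fun y =>
    (hgb y).trans (le_mul_of_one_le_right (by positivity) (hW1 y))
  have hgrow : ∀ (f : ℝ → ℂ) (D : ℝ), (∀ t, ‖f t‖ ≤ D * ((1 + |t|) ^ k * W t)) →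
      ∀ t, ‖f t‖ ≤ D * L * (1 + |t|) ^ k := fun f D hfb t => by
    have hD : 0 ≤ D := by
      by_contra hD
      have := (norm_nonneg (f 0)).trans (hfb 0)
      nlinarith [hw1 0, not_le.1 hD]
    calc ‖f t‖ ≤ D * ((1 + |t|) ^ k * W t) := hfb t
      _ ≤ D * ((1 + |t|) ^ k * L) := by gcongr; exact hWL t
      _ = D * L * (1 + |t|) ^ k := by ring
  obtain ⟨T, hT, hTn, ⟨n, hn⟩, huniq⟩ :=
    exists_op (K := fun y t => (volterraKernel α (t - y) : ℂ) * V t) hwc hw1 hg hgb'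
      (fun f D hD hfb y =>
        norm_volterra_le hk hα hVb hW1 (fun y => (hW y).1) (fun y => (hW y).2) hD hfb y)
      (fun f hf D hfb y => integrableOn_volterra hα hV hVb hf (hgrow f D hfb) y)
      (fun f hf D hfb => continuous_volterra hα hV hVb hf (hgrow f D hfb))
  -- every continuous solution of growth `k` is `w ·` a fixed point of `T`
  have hsol : ∀ m : ℝ → ℂ, Continuous m → (∃ B : ℝ, ∀ y, ‖m y‖ ≤ B * (1 + |y|) ^ k) →
      (∀ y, m y = g y + ∫ t in Ioi y, (volterraKernel α (t - y) : ℂ) * V t * m t) →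
      ∃ n' : ℝ →ᵇ ℂ, T n' = n' ∧ ∀ y, m y = (((1 + |y|) ^ k * W y : ℝ) : ℂ) * n' y := by
    rintro m hm ⟨B, hB⟩ he
    have hc : Continuous fun y => ((((1 + |y|) ^ k * W y)⁻¹ : ℝ) : ℂ) * m y :=
      (Complex.continuous_ofReal.comp (hwc.inv₀ fun y => (hw0 y).ne')).mul hm
    have hb : ∀ y, ‖((((1 + |y|) ^ k * W y)⁻¹ : ℝ) : ℂ) * m y‖ ≤ |B| := fun y => by
      rw [norm_mul, Complex.norm_real, Real.norm_of_nonneg (inv_nonneg.2 (hw0 y).le),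
        inv_mul_le_iff₀ (hw0 y)]
      calc ‖m y‖ ≤ B * (1 + |y|) ^ k := hB y
        _ ≤ |B| * (1 + |y|) ^ k := by gcongr; exact le_abs_self B
        _ ≤ |B| * ((1 + |y|) ^ k * W y) := by
            gcongr
            exact le_mul_of_one_le_right (by positivity) (hW1 y)
        _ = (1 + |y|) ^ k * W y * |B| := mul_comm _ _
    obtain ⟨n', hn'⟩ : ∃ n' : ℝ →ᵇ ℂ, ∀ y, n' y = ((((1 + |y|) ^ k * W y)⁻¹ : ℝ) : ℂ) * m y :=
      ⟨BoundedContinuousFunction.ofNormedAddCommGroup _ hc _ hb, fun y => rfl⟩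
    have hmn : ∀ y, m y = (((1 + |y|) ^ k * W y : ℝ) : ℂ) * n' y := fun y => by
      rw [hn', ← mul_assoc, ← Complex.ofReal_mul, mul_inv_cancel₀ (hw0 y).ne',
        Complex.ofReal_one, one_mul]
    refine ⟨n', ?_, hmn⟩
    ext y
    rw [hT]
    show ((((1 + |y|) ^ k * W y)⁻¹ : ℝ) : ℂ) * (g y + ∫ t in Ioi y,
      (volterraKernel α (t - y) : ℂ) * V t * ((((1 + |t|) ^ k * W t : ℝ) : ℂ) * n' t)) = n' y
    have hfun : (fun t => (volterraKernel α (t - y) : ℂ) * V t *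
        ((((1 + |t|) ^ k * W t : ℝ) : ℂ) * n' t)) =
        fun t => (volterraKernel α (t - y) : ℂ) * V t * m t := funext fun t => by rw [hmn t]
    rw [hfun, ← he y, hn']
  constructor
  · have hn2 : ‖n‖ ≤ 2 := by have := hTn n; rw [hn] at this; linarith
    refine ⟨fun y => (((1 + |y|) ^ k * W y : ℝ) : ℂ) * n y,
      (Complex.continuous_ofReal.comp hwc).mul n.continuous, fun y => ?_, fun y => ?_⟩
    · rw [norm_mul, Complex.norm_of_nonneg (hw0 y).le]
      calc (1 + |y|) ^ k * W y * ‖n y‖ ≤ (1 + |y|) ^ k * L * 2 := by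
            gcongr
            · exact hWL y
            · exact (n.norm_coe_le_norm y).trans hn2
        _ = 2 * L * (1 + |y|) ^ k := by ring
    · show (((1 + |y|) ^ k * W y : ℝ) : ℂ) * n y = g y + ∫ t in Ioi y,
        (volterraKernel α (t - y) : ℂ) * V t * ((((1 + |t|) ^ k * W t : ℝ) : ℂ) * n t)
      have h := hT n y
      rw [hn] at h
      rw [h, ← mul_assoc, ← Complex.ofReal_mul, mul_inv_cancel₀ (hw0 y).ne', Complex.ofReal_one,
        one_mul]
  · rintro m₁ m₂ hm₁ hm₂ hB₁ hB₂ he₁ he₂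
    obtain ⟨n₁, hn₁, hmn₁⟩ := hsol m₁ hm₁ hB₁ he₁
    obtain ⟨n₂, hn₂, hmn₂⟩ := hsol m₂ hm₂ hB₂ he₂
    have h12 := huniq n₁ n₂ hn₁ hn₂
    funext y
    rw [hmn₁, hmn₂, h12]

/-- **Registered stub `stub_volterra`** of the line `Sketch` (crux stmt-AnomalousDissipation-3008):
the weighted Volterra theory on `ℝ` with weight `(1+|y|)^k`, `k ≥ 1`, and potential size `A`
(for `A < 0` the class of potentials only shrinks, so the constant for `max A 0` works). [folklore] -/
theorem stub_volterra : ∀ k : ℕ, 1 ≤ k → ∀ A : ℝ, VolterraPackage k A := by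
  intro k hk A
  obtain ⟨C, hC⟩ := volterraPackage_of_nonneg hk (le_max_right A 0)
  refine ⟨C, fun α hα0 hα1 V hV hVb => hC α hα0 hα1 V hV fun t => (hVb t).trans ?_⟩
  exact mul_le_mul_of_nonneg_right (le_max_left _ _) (Real.exp_pos _).le

end Summit.AnomalousDissipation.AnomalousDissipation.Theorems.BurgersLayerKH.Sheet.Volterra

end
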